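import Mathlib
import HarnessLib
import Literature.MathematicalPhysics.QuantumLattice.GrassmannWeightedEffectiveActionGradedTruncationDB
import Literature.MathematicalPhysics.QuantumLattice.SectorisedIncrementBoundBinomialWeightedPlateau
import Literature.MathematicalPhysics.QuantumLattice.GrassmannWeightedKernelYoung
import Literature.MathematicalPhysics.QuantumLattice.GrassmannSourceGradedStep
import Summits.HubbardSuperconductivity.HubbardSuperconductivity.Theorems.KLProgrammeKLRegimeTwoVolumeSpectatorLegs
import Summits.HubbardSuperconductivity.HubbardSuperconductivity.Theorems.KLProgrammeKLRegimeTwoVolumeDoubledData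

/-!
# Route `KLProgramme` — crux K3, VL child `KLRegimeVolumeLimitV17F3` (stmt-HubbardSuperconductivity-23356), producer route «(VL)-SRC-SOFT» §S2:
# THE SOURCE-SPECIES BLOCK STEP — the engine's BLIND graded / binomial weighted doors on the doubled labels, with the species read off by
# exact source rescaling (seat hubbard-kl-k3c4-p1 g19; `--supports` 23356)

The producer stub `stub_vl_srcProfiles` quantifies its amplitude `A` AFTER `β`; it therefore needs, per block of scales, only a bound of the
source-species profiles (exactly `s ∈ {1, 2}` plain «source» legs on copy `1`, the other legs analysed at the alive family on copy `0`) of the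
block's output that is LINEAR (`s = 1`) / at most quadratic (`s = 2`) in the species amplitudes and carries the engine's GRADED degree law on the
alive legs.  This file proves that bound GENERICALLY (labels `Γ₁ × Fin 2 → Γ₂ × Fin 2`, any tree weight on a position set `Λ`, both copies of a label
at the same position), as a reading of tree lemmas:

* the spectator covariance `C⁺` of the block covariance `C` (`…TwoVolumeSpectatorLegs`: zero on the source copy, replica-Gram constant and
  weighted rows inherited — `isGramBoundedR_spectator`, `…DoubledData.sum_norm_spectatorCov_mul_row_le/_col_le`);
* EXACT SOURCE RESCALING (`GrassmannSourceGradedStep`, k3c4-p1 g10): `S_t` multiplies every source leg by `t`; `effAction C⁺` and every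
  copy-preserving substitution commute with `S_t` (`effAction_map_mulLeft_srcWeight`, `map_map_mulLeft_srcWeight_comm`), kernels scale by
  `t^{#sources}` (`kernel_map_mulLeft_srcWeight`); SOURCE TRUNCATION `srcTrunc 3` (`GrassmannSourceGrading`, p566122) discards species `≥ 3`
  and commutes with «substitution ∘ step» on species `≤ 2` (`srcTrunc_map_effAction_srcTrunc`, `kernel_srcTrunc_of_lt`);
* the engine's BLIND weighted doors on the doubled labels: graded orders `≥ 2`
  (`GrassmannWeightedEffectiveActionGradedTruncationDB.sum_wt_norm_kernel_effAction_sub_gaussConv_le_graded_of_gramBounded`), binomial first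
  order (`SectorisedIncrementBoundBinomialWeightedPlateau.sum_wt_norm_kernel_gaussConv_sub_le_binomial_of_gramBounded_wt`), zeroth order and the
  read-out through the block substitution `T⁺` by the weighted Young inequality (`GrassmannWeightedKernelYoung.sum_filter_wt_norm_kernel_map_le`).

Contents:
* §1 `sum_filter_norm_kernel_srcTrunc_srcWeight_le` — the blind pinned profile of `V_t := srcTrunc 3 (S_t D)` is `≤ N₀ + t·N₁ + t²·N₂` from the
  species profiles `N_s` of `D` (`0 ≤ t`);  `srcTrunc_srcWeight_mem_evenPart`, `constPart_srcTrunc_srcWeight`;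
* §2 **`sum_species_norm_kernel_map_effAction_eq`** — species read-off: on the strings with exactly `s ≤ 2` source legs the kernels of
  `map f (effAction C⁺ D)` are `t^{-s}` times those of `map f (effAction C⁺ V_t)` (any copy-compatible `f`, any `C⁺` vanishing on the sources,
  `constPart D = 0`);
* §3 **`sum_species_wt_norm_kernel_blockStep_le`** — THE SOURCE-SPECIES BLOCK STEP: with `C⁺` the spectator of a replica-Gram-bounded (`κ`) block
  covariance with weighted rows/columns `≤ α`, `D` even without constant part with species profiles `N₀, N₁, N₂`, `T⁺` any copy-compatible
  substitution with weighted costs `(cr, cc)`, `0 < t`, radius `ρ`, `θ_t = eα‖N_t‖_h/κ² < 1` (`N_t := N₀ + tN₁ + t²N₂`), `N₀′ ≥ 2`: in every even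
  degree `2(q+1)`, one output leg pinned, for `s ≤ 2`,
  `Σ_{X″_p = w″, #src X″ = s} wt(π″X″)·‖kernel (map T⁺ (effAction C⁺ D)) (2(q+1)) X″‖ ≤ t^{-s}·cr·cc^{2q+1}·[N_t(q+1) + binomial(N_t) + graded(N_t)]`
  — the alive legs carry the graded law of the blind doors, the species amplitudes enter through `N_t` only, and `t` is free (the producer takes
  `t ≍ law(2)/A`, so that the source two-leg kernels never enter `θ`).

Generic (`RCLike 𝕜`); proofs only, no definition; nothing about the Hubbard model is asserted.  The model instance (block covariance
`S(F̃_{J₁−1})ᵀ C^{K_top}_{(Λ_{J₂},Λ_{J₁}]} S(F̃_{J₁−1})`, `T⁺ = (ε•E(F_{J′})S(F̃)) ⊕ J`, identity `…TwoVolumeSrcBlockIdentity`) is the next file.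
References: BGM 2006 §2.7 (2.61)–(2.63), (2.80)–(2.83), §2.9 (4.3)–(4.8), §3 (3.2)–(3.8) [cite: BenfattoGiulianiMastropietro2006];
Gawȩdzki–Kupiainen 1985 §3.
-/

noncomputable section

namespace Summit.HubbardSuperconductivity.HubbardSuperconductivity.Theorems.TwoVolumeDefect

set_option linter.dupNamespace false -- summit = problem name (single-conjunct summit), D-0017

open Finset Literature.MathematicalPhysics.QuantumLattice GrassmannAlgebra Literature.Probability.LatticeModels
open Literature.Probability.LatticeModels.BattleFederbush
open scoped Nat

universe u

variable {𝕜 : Type*} [RCLike 𝕜]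

/-! ## §1 The blind profile of the rescaled, truncated input -/

section Input

variable {Γ : Type u} [Fintype Γ] [DecidableEq Γ]

/-- **The blind pinned profile of `V_t := srcTrunc 3 (S_t D)` from the species profiles of `D`**: on any finite set `S` of strings and for any
nonnegative string weight `g`, if the species-`s` parts of `Σ_{W ∈ S} ‖kernel D m W‖·g W` are `≤ N_s` (`s = 0, 1, 2`), then
`Σ_{W ∈ S} ‖kernel V_t m W‖·g W ≤ N₀ + t·N₁ + t²·N₂` (`0 ≤ t`). [cite: BenfattoGiulianiMastropietro2006, §2.9 (4.6)-(4.8)] -/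
theorem sum_filter_norm_kernel_srcTrunc_srcWeight_le {t : ℝ} (ht0 : 0 ≤ t) (D : GrassmannAlgebra 𝕜 (Γ × Fin 2)) {m : ℕ}
    (S : Finset (Fin m → Γ × Fin 2)) (g : (Fin m → Γ × Fin 2) → ℝ) {N₀ N₁ N₂ : ℝ}
    (h0 : ∑ W ∈ S.filter (fun W => srcCount (fun Y : Γ × Fin 2 => Y.2 = 1) W = 0), ‖kernel 𝕜 D m W‖ * g W ≤ N₀)
    (h1 : ∑ W ∈ S.filter (fun W => srcCount (fun Y : Γ × Fin 2 => Y.2 = 1) W = 1), ‖kernel 𝕜 D m W‖ * g W ≤ N₁)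
    (h2 : ∑ W ∈ S.filter (fun W => srcCount (fun Y : Γ × Fin 2 => Y.2 = 1) W = 2), ‖kernel 𝕜 D m W‖ * g W ≤ N₂) :
    ∑ W ∈ S, ‖kernel 𝕜 (srcTrunc 𝕜 (fun Y : Γ × Fin 2 => Y.2 = 1) 3
        (ExteriorAlgebra.map (LinearMap.mulLeft 𝕜 (fun Y => if Y.2 = 1 then ((t : ℝ) : 𝕜) else 1)) D)) m W‖ * g W ≤
      N₀ + t * N₁ + t ^ 2 * N₂ := by
  -- pointwise: the truncated rescaled kernel is `[#src < 3]·t^{#src}·kernel D`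
  have hpt : ∀ W : Fin m → Γ × Fin 2, ‖kernel 𝕜 (srcTrunc 𝕜 (fun Y : Γ × Fin 2 => Y.2 = 1) 3
      (ExteriorAlgebra.map (LinearMap.mulLeft 𝕜 (fun Y => if Y.2 = 1 then ((t : ℝ) : 𝕜) else 1)) D)) m W‖ * g W =
      (if srcCount (fun Y : Γ × Fin 2 => Y.2 = 1) W = 0 then ‖kernel 𝕜 D m W‖ * g W else 0) +
        t * (if srcCount (fun Y : Γ × Fin 2 => Y.2 = 1) W = 1 then ‖kernel 𝕜 D m W‖ * g W else 0) +
        t ^ 2 * (if srcCount (fun Y : Γ × Fin 2 => Y.2 = 1) W = 2 then ‖kernel 𝕜 D m W‖ * g W else 0) := by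
    intro W
    rw [kernel_srcTrunc]
    by_cases hlt : srcCount (fun Y : Γ × Fin 2 => Y.2 = 1) W < 3
    · rw [if_pos hlt, kernel_map_mulLeft_srcWeight, norm_mul, norm_pow, RCLike.norm_ofReal, abs_of_nonneg ht0]
      rcases Nat.lt_succ_iff.1 hlt |>.eq_or_lt with h2 | h2
      · simp [h2]; ring
      rcases Nat.lt_succ_iff.1 h2 |>.eq_or_lt with h1 | h1
      · simp [h1]; ring
      have h0 : srcCount (fun Y : Γ × Fin 2 => Y.2 = 1) W = 0 := by omega
      simp [h0]
    · rw [if_neg hlt, norm_zero, zero_mul]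
      have h0 : srcCount (fun Y : Γ × Fin 2 => Y.2 = 1) W ≠ 0 := by omega
      have h1 : srcCount (fun Y : Γ × Fin 2 => Y.2 = 1) W ≠ 1 := by omega
      have h2 : srcCount (fun Y : Γ × Fin 2 => Y.2 = 1) W ≠ 2 := by omega
      simp [h0, h1, h2]
  rw [sum_congr rfl fun W _ => hpt W, sum_add_distrib, sum_add_distrib, ← mul_sum, ← mul_sum, ← sum_filter, ← sum_filter, ← sum_filter]
  exact add_le_add (add_le_add h0 (mul_le_mul_of_nonneg_left h1 ht0)) (mul_le_mul_of_nonneg_left h2 (pow_nonneg ht0 2))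

/-- The rescaled truncated input is even when `D` is. [folklore] -/
theorem srcTrunc_srcWeight_mem_evenPart (t : 𝕜) {D : GrassmannAlgebra 𝕜 (Γ × Fin 2)} (hD : D ∈ evenPart 𝕜 (Γ × Fin 2)) :
    srcTrunc 𝕜 (fun Y : Γ × Fin 2 => Y.2 = 1) 3 (ExteriorAlgebra.map (LinearMap.mulLeft 𝕜 (fun Y => if Y.2 = 1 then t else 1)) D) ∈ evenPart 𝕜 (Γ × Fin 2) :=
  srcTrunc_mem_evenPart 𝕜 (fun Y : Γ × Fin 2 => Y.2 = 1) 3 (mem_evenPart_iff.2 (map_mem_evenOdd_zero 𝕜 _ (mem_evenPart_iff.1 hD)))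

/-- The rescaled truncated input has no constant part when `D` has none. [folklore] -/
theorem constPart_srcTrunc_srcWeight (t : 𝕜) {D : GrassmannAlgebra 𝕜 (Γ × Fin 2)} (hD0 : constPart 𝕜 D = 0) :
    constPart 𝕜 (srcTrunc 𝕜 (fun Y : Γ × Fin 2 => Y.2 = 1) 3 (ExteriorAlgebra.map (LinearMap.mulLeft 𝕜 (fun Y => if Y.2 = 1 then t else 1)) D)) = 0 :=
  constPart_srcTrunc_eq_zero 𝕜 (fun Y : Γ × Fin 2 => Y.2 = 1) 3 (by rw [constPart_map, hD0])

end Input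

/-! ## §2 Reading off the species by exact rescaling -/

section Species

variable {Γ₁ Γ₂ : Type u} [Fintype Γ₁] [DecidableEq Γ₁] [Fintype Γ₂] [DecidableEq Γ₂]

/-- **Species read-off**: `C⁺` vanishing on the sources, `D` without constant part, `f` copy-compatible (`M X″ X ≠ 0 ⇒ (X source ↔ X″ source)`),
`0 < t`, `s ≤ 2`: on the strings with exactly `s` source legs, `‖kernel (map f (effAction C⁺ D))‖ = t^{-s}·‖kernel (map f (effAction C⁺ V_t))‖` with
`V_t := srcTrunc 3 (S_t D)`; summed against any string weight. [cite: BenfattoGiulianiMastropietro2006, §2.9 (4.6)-(4.8)] -/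
theorem sum_species_norm_kernel_map_effAction_eq (C' : Matrix (Γ₁ × Fin 2) (Γ₁ × Fin 2) 𝕜)
    (hCsrc : ∀ X Y, X.2 = 1 ∨ Y.2 = 1 → C' X Y = 0) (D : GrassmannAlgebra 𝕜 (Γ₁ × Fin 2)) (hD0 : constPart 𝕜 D = 0)
    (f : (Γ₁ × Fin 2 → 𝕜) →ₗ[𝕜] (Γ₂ × Fin 2 → 𝕜)) (hf : ∀ (X : Γ₁ × Fin 2) (X'' : Γ₂ × Fin 2), LinearMap.toMatrix' f X'' X ≠ 0 → (X.2 = 1 ↔ X''.2 = 1))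
    {t : ℝ} (ht : 0 < t) {m : ℕ} (S : Finset (Fin m → Γ₂ × Fin 2)) (g : (Fin m → Γ₂ × Fin 2) → ℝ) {s : ℕ} (hs : s < 3) :
    ∑ X'' ∈ S.filter (fun X'' => srcCount (fun Y : Γ₂ × Fin 2 => Y.2 = 1) X'' = s), ‖kernel 𝕜 (ExteriorAlgebra.map f (effAction 𝕜 C' D)) m X''‖ * g X'' =
      t⁻¹ ^ s * ∑ X'' ∈ S.filter (fun X'' => srcCount (fun Y : Γ₂ × Fin 2 => Y.2 = 1) X'' = s),
        ‖kernel 𝕜 (ExteriorAlgebra.map f (effAction 𝕜 C' (srcTrunc 𝕜 (fun Y : Γ₁ × Fin 2 => Y.2 = 1) 3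
          (ExteriorAlgebra.map (LinearMap.mulLeft 𝕜 (fun Y => if Y.2 = 1 then ((t : ℝ) : 𝕜) else 1)) D)))) m X''‖ * g X'' := by
  have hCsrc' : ∀ X Y, X.2 = 1 ∨ Y.2 = 1 → C' X Y = 0 := hCsrc
  have hf' : ∀ (X : Γ₁ × Fin 2) (X'' : Γ₂ × Fin 2), X.2 = 1 → ¬ X''.2 = 1 → LinearMap.toMatrix' f X'' X = 0 := by
    intro X X'' hX hX''
    by_contra hne
    exact hX'' ((hf X X'' hne).1 hX)
  -- rescaling the sources of `D` rescales the kernels of `map f (effAction C⁺ D)` by `t^{#src}`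
  set St : GrassmannAlgebra 𝕜 (Γ₁ × Fin 2) →ₗ[𝕜] GrassmannAlgebra 𝕜 (Γ₁ × Fin 2) :=
    (ExteriorAlgebra.map (LinearMap.mulLeft 𝕜 (fun Y => if Y.2 = 1 then ((t : ℝ) : 𝕜) else 1))).toLinearMap with hSt
  have hDt : constPart 𝕜 (ExteriorAlgebra.map (LinearMap.mulLeft 𝕜 (fun Y => if Y.2 = 1 then ((t : ℝ) : 𝕜) else 1)) D) = 0 := by
    rw [constPart_map, hD0]
  have hker : ∀ X'' : Fin m → Γ₂ × Fin 2, srcCount (fun Y : Γ₂ × Fin 2 => Y.2 = 1) X'' = s →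
      kernel 𝕜 (ExteriorAlgebra.map f (effAction 𝕜 C' (srcTrunc 𝕜 (fun Y : Γ₁ × Fin 2 => Y.2 = 1) 3
          (ExteriorAlgebra.map (LinearMap.mulLeft 𝕜 (fun Y => if Y.2 = 1 then ((t : ℝ) : 𝕜) else 1)) D)))) m X'' =
        ((t : ℝ) : 𝕜) ^ s * kernel 𝕜 (ExteriorAlgebra.map f (effAction 𝕜 C' D)) m X'' := by
    intro X'' hX''
    have hlt : srcCount (fun Y : Γ₂ × Fin 2 => Y.2 = 1) X'' < 3 := hX'' ▸ hs
    rw [← kernel_srcTrunc_of_lt 𝕜 (fun Y : Γ₂ × Fin 2 => Y.2 = 1) (k := 3) _ hlt, srcTrunc_map_effAction_srcTrunc 𝕜 (fun Y : Γ₁ × Fin 2 => Y.2 = 1) C' (fun Y : Γ₂ × Fin 2 => Y.2 = 1) hCsrc' f hf' 3 hDt,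
      kernel_srcTrunc_of_lt 𝕜 (fun Y : Γ₂ × Fin 2 => Y.2 = 1) (k := 3) _ hlt, effAction_map_mulLeft_srcWeight 𝕜 (fun Y : Γ₁ × Fin 2 => Y.2 = 1) ((t : ℝ) : 𝕜) C' hCsrc' D,
      map_map_mulLeft_srcWeight_comm 𝕜 (fun Y : Γ₁ × Fin 2 => Y.2 = 1) (fun Y : Γ₂ × Fin 2 => Y.2 = 1) f hf, kernel_map_mulLeft_srcWeight, hX'']
  have htk : ((t : ℝ) : 𝕜) ≠ 0 := by exact_mod_cast ht.ne'
  rw [mul_sum]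
  refine sum_congr rfl fun X'' hX'' => ?_
  rw [hker X'' (mem_filter.1 hX'').2, norm_mul, norm_pow, RCLike.norm_ofReal, abs_of_pos ht, ← mul_assoc, ← mul_assoc, ← mul_pow,
    inv_mul_cancel₀ ht.ne', one_pow, one_mul]

end Species

/-! ## §3 The source-species block step -/

section Step

variable {Γ₁ Γ₂ : Type u} [Fintype Γ₁] [DecidableEq Γ₁] [Fintype Γ₂] [DecidableEq Γ₂] {Λ : Type*} [DecidableEq Λ] {wt : Finset Λ → ℝ}

omit [Fintype Γ₁] in
/-- Pair weights pulled back along a position map. [folklore] -/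
private theorem wt_image_pair' (π : Γ₁ × Fin 2 → Λ) (X Y : Γ₁ × Fin 2) : wt (({X, Y} : Finset (Γ₁ × Fin 2)).image π) = wt {π X, π Y} := by
  rw [image_insert, image_singleton]

/-- **THE SOURCE-SPECIES BLOCK STEP** (BGM 2006 §2.9 «the external field rides on the flow», with (2.61)–(2.63), (2.80)–(2.83), §3 (3.2)–(3.8)).
Data: a tree weight `wt` on `Finset Λ`, positions `π₁ : Γ₁ → Λ`, `π₂ : Γ₂ → Λ` (both copies of a label sit at the same position); the block covariance `C`
on `Γ₁`, replica-Gram-bounded (`κ > 0`) with weighted rows/columns `≤ α`, and its spectator `C⁺`; `D` even without constant part on `Γ₁ × Fin 2` with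
species profiles `N₀, N₁, N₂` (weighted pinned sums over the strings with exactly `0, 1, 2` source legs, every degree, every pin); a copy-compatible
substitution `T⁺` (matrix `Tp`) with weighted costs `(cr, cc)`; `0 < t`; `ρ > 0` with `θ_t := eα‖N_t‖_h/κ² < 1`, `N_t := N₀ + tN₁ + t²N₂`; `N₀′ ≥ 2`.
Then for `s ≤ 2`, every `q`, one output leg pinned at `w″`:
`Σ_{X″_p = w″, #src X″ = s} wt(π₂X″)·‖kernel (map T⁺ (effAction C⁺ D)) (2(q+1)) X″‖ ≤ t^{-s}·cr·cc^{2q+1}·[N_t(q+1) + binomial_{q+1}(N_t) + graded_{2q+2}(N_t)]`.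
[cite: BenfattoGiulianiMastropietro2006, §2.9 (4.3)-(4.8), (2.61)-(2.63), (2.80)-(2.83), (3.2)-(3.8)] -/
theorem sum_species_wt_norm_kernel_blockStep_le (hwt : IsTreeWeight wt) (π₁ : Γ₁ → Λ) (π₂ : Γ₂ → Λ)
    (C : Matrix Γ₁ Γ₁ 𝕜) (C' : Matrix (Γ₁ × Fin 2) (Γ₁ × Fin 2) 𝕜)
    (hC' : ∀ p q, C' p q = if p.2 = 0 ∧ q.2 = 0 then C p.1 q.1 else 0)
    {κ : ℝ} (hκ : 0 < κ) (hGB : IsGramBoundedR C κ)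
    {α : ℝ} (hα : 0 < α)
    (hrow : ∀ x, ∑ y, ‖C x y‖ * wt {π₁ x, π₁ y} ≤ α) (hcol : ∀ y, ∑ x, ‖C x y‖ * wt {π₁ x, π₁ y} ≤ α)
    (D : GrassmannAlgebra 𝕜 (Γ₁ × Fin 2)) (hD : D ∈ evenPart 𝕜 (Γ₁ × Fin 2)) (hD0 : constPart 𝕜 D = 0)
    (N₀ N₁ N₂ : ℕ → ℝ) (hN₀0 : ∀ m', 0 ≤ N₀ m') (hN₁0 : ∀ m', 0 ≤ N₁ m') (hN₂0 : ∀ m', 0 ≤ N₂ m')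
    (hN : ∀ (s : ℕ), s < 3 → ∀ (m' : ℕ) (j : Fin (2 * m')) (w : Γ₁ × Fin 2),
      ∑ Y ∈ univ.filter (fun Y : Fin (2 * m') → Γ₁ × Fin 2 => Y j = w ∧ srcCount (fun Y : Γ₁ × Fin 2 => Y.2 = 1) Y = s),
        ‖kernel 𝕜 D (2 * m') Y‖ * wt ((univ.image Y).image (fun Y : Γ₁ × Fin 2 => π₁ Y.1)) ≤
        (if s = 0 then N₀ m' else if s = 1 then N₁ m' else N₂ m'))
    (Tp : Matrix (Γ₂ × Fin 2) (Γ₁ × Fin 2) 𝕜) (hTsrc : ∀ (X : Γ₁ × Fin 2) (X'' : Γ₂ × Fin 2), Tp X'' X ≠ 0 → (X.2 = 1 ↔ X''.2 = 1))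
    {cr cc : ℝ} (hcc0 : 0 ≤ cc)
    (hrow' : ∀ X'', ∑ X, ‖Tp X'' X‖ * wt {π₂ X''.1, π₁ X.1} ≤ cr) (hcol' : ∀ X, ∑ X'', ‖Tp X'' X‖ * wt {π₂ X''.1, π₁ X.1} ≤ cc)
    {t : ℝ} (ht : 0 < t) {ρ : ℝ} (hρ : 0 < ρ)
    (hθ : Real.exp 1 * α * normV (Γ₁ × Fin 2) κ ρ (fun m' => N₀ m' + t * N₁ m' + t ^ 2 * N₂ m') / κ ^ 2 < 1)
    {N₀' : ℕ} (hN₀' : 2 ≤ N₀') {s : ℕ} (hs : s < 3) (q : ℕ) (p : Fin (2 * (q + 1))) (w'' : Γ₂ × Fin 2) :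
    ∑ X'' ∈ univ.filter (fun X'' : Fin (2 * (q + 1)) → Γ₂ × Fin 2 => X'' p = w'' ∧ srcCount (fun Y : Γ₂ × Fin 2 => Y.2 = 1) X'' = s),
        wt ((univ.image X'').image (fun Y : Γ₂ × Fin 2 => π₂ Y.1)) *
          ‖kernel 𝕜 (ExteriorAlgebra.map (Matrix.toLin' Tp) (effAction 𝕜 C' D)) (2 * (q + 1)) X''‖ ≤
      t⁻¹ ^ s * (cr * cc ^ (2 * q + 1) *
        ((N₀ (q + 1) + t * N₁ (q + 1) + t ^ 2 * N₂ (q + 1)) +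
         (∑ m' ∈ range (Fintype.card (Γ₁ × Fin 2) / 2 + 1),
            if q + 1 < m' then ((2 * m').choose (2 * (q + 1)) : ℝ) * κ ^ (2 * m' - 2 * (q + 1)) *
              (N₀ m' + t * N₁ m' + t ^ 2 * N₂ m') else 0) +
         (∑ n ∈ Ico 2 N₀', (ρ⁻¹ ^ (2 * (q + 1)) * κ⁻¹ ^ (2 * (n - 1)) * (α ^ (n - 1) * Real.exp n)) *
              ∑ δ ∈ (Fintype.piFinset fun _ : Fin n => range (Fintype.card (Γ₁ × Fin 2) / 2 + 1)) with
                  2 * (q + 1) + 2 * (n - 1) ≤ ∑ a, 2 * δ a,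
                ∏ a, (Real.exp 2 * (κ + ρ)) ^ (2 * δ a) * (N₀ (δ a) + t * N₁ (δ a) + t ^ 2 * N₂ (δ a)) +
            ρ⁻¹ ^ (2 * (q + 1)) * (Real.exp 1 * normV (Γ₁ × Fin 2) κ ρ (fun m' => N₀ m' + t * N₁ m' + t ^ 2 * N₂ m')) *
              (Real.exp 1 * α * normV (Γ₁ × Fin 2) κ ρ (fun m' => N₀ m' + t * N₁ m' + t ^ 2 * N₂ m') / κ ^ 2) ^ (N₀' - 1) /
              (1 - Real.exp 1 * α * normV (Γ₁ × Fin 2) κ ρ (fun m' => N₀ m' + t * N₁ m' + t ^ 2 * N₂ m') / κ ^ 2)))) := by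
  -- abbreviations
  set Nt : ℕ → ℝ := fun m' => N₀ m' + t * N₁ m' + t ^ 2 * N₂ m' with hNt
  set V : GrassmannAlgebra 𝕜 (Γ₁ × Fin 2) := srcTrunc 𝕜 (fun Y : Γ₁ × Fin 2 => Y.2 = 1) 3
    (ExteriorAlgebra.map (LinearMap.mulLeft 𝕜 (fun Y => if Y.2 = 1 then ((t : ℝ) : 𝕜) else 1)) D) with hV
  set πd₁ : Γ₁ × Fin 2 → Λ := fun Y => π₁ Y.1 with hπd₁
  set πd₂ : Γ₂ × Fin 2 → Λ := fun Y => π₂ Y.1 with hπd₂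
  set wt₁ : Finset (Γ₁ × Fin 2) → ℝ := fun S => wt (S.image πd₁) with hwt₁
  have hwt₁tree : IsTreeWeight wt₁ := hwt.comap πd₁
  have hNt0 : ∀ m', 0 ≤ Nt m' := fun m' => by
    simp only [hNt]; exact add_nonneg (add_nonneg (hN₀0 m') (mul_nonneg ht.le (hN₁0 m'))) (mul_nonneg (pow_nonneg ht.le 2) (hN₂0 m'))
  -- the input `V` : even, no constant part, blind profile `≤ N_t`
  have hVe : V ∈ evenPart 𝕜 (Γ₁ × Fin 2) := srcTrunc_srcWeight_mem_evenPart _ hD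
  have hV0 : constPart 𝕜 V = 0 := constPart_srcTrunc_srcWeight _ hD0
  have hVN : ∀ (m' : ℕ) (j : Fin (2 * m')) (w : Γ₁ × Fin 2),
      ∑ Y ∈ univ.filter (fun Y : Fin (2 * m') → Γ₁ × Fin 2 => Y j = w), ‖kernel 𝕜 V (2 * m') Y‖ * wt₁ (univ.image Y) ≤ Nt m' := by
    intro m' j w
    have hfilt : ∀ s : ℕ, (univ.filter (fun Y : Fin (2 * m') → Γ₁ × Fin 2 => Y j = w)).filter (fun Y => srcCount (fun Y : Γ₁ × Fin 2 => Y.2 = 1) Y = s) =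
        univ.filter (fun Y : Fin (2 * m') → Γ₁ × Fin 2 => Y j = w ∧ srcCount (fun Y : Γ₁ × Fin 2 => Y.2 = 1) Y = s) := fun s => by
      rw [filter_filter]
    refine sum_filter_norm_kernel_srcTrunc_srcWeight_le ht.le D _ (fun Y => wt₁ (univ.image Y)) ?_ ?_ ?_
    · rw [hfilt]; simpa using hN 0 (by norm_num) m' j w
    · rw [hfilt]; simpa using hN 1 (by norm_num) m' j w
    · rw [hfilt]; simpa using hN 2 (by norm_num) m' j w
  -- the spectator covariance: Gram constant, weighted rows/columns, vanishing on the sources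
  have hGB' : IsGramBoundedR C' κ := isGramBoundedR_spectator C C' hC' hGB
  have hrow₁ : ∀ X, ∑ Y, ‖C' X Y‖ * wt₁ {X, Y} ≤ α := by
    intro X
    have h := sum_norm_spectatorCov_mul_row_le C C' hC' (fun Y => wt {πd₁ X, πd₁ Y}) X hα.le (hrow X.1)
    simpa only [hwt₁, wt_image_pair'] using h
  have hcol₁ : ∀ Y, ∑ X, ‖C' X Y‖ * wt₁ {X, Y} ≤ α := by
    intro Y
    have h := sum_norm_spectatorCov_mul_col_le C C' hC' (fun X => wt {πd₁ X, πd₁ Y}) Y hα.le (hcol Y.1)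
    simpa only [hwt₁, wt_image_pair'] using h
  have hCsrc : ∀ X Y, X.2 = 1 ∨ Y.2 = 1 → C' X Y = 0 := by
    intro X Y hXY
    have hn : ¬ (X.2 = 0 ∧ Y.2 = 0) := by
      rintro ⟨hX0, hY0⟩
      rcases hXY with h | h
      · rw [hX0] at h; exact zero_ne_one h
      · rw [hY0] at h; exact zero_ne_one h
    rw [hC', if_neg hn]
  -- the three blind pieces on `V`, each read through `T⁺` by the weighted Young inequality
  have hTm : ∀ X'' X, LinearMap.toMatrix' (Matrix.toLin' Tp) X'' X = Tp X'' X := fun X'' X => by rw [LinearMap.toMatrix'_toLin']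
  have hrowT : ∀ X'', ∑ X, ‖LinearMap.toMatrix' (Matrix.toLin' Tp) X'' X‖ * wt {πd₂ X'', πd₁ X} ≤ cr := fun X'' => by
    simp only [hTm]; exact hrow' X''
  have hcolT : ∀ X, ∑ X'', ‖LinearMap.toMatrix' (Matrix.toLin' Tp) X'' X‖ * wt {πd₂ X'', πd₁ X} ≤ cc := fun X => by
    simp only [hTm]; exact hcol' X
  -- (P0) zeroth order: `map T⁺ V` (the degree `2(q+1)` is definitionally `(2q+1)+1`)
  have hVN' : ∀ (j : Fin (2 * q + 1 + 1)) (x : Γ₁ × Fin 2),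
      ∑ Y ∈ univ.filter (fun Y : Fin (2 * q + 1 + 1) → Γ₁ × Fin 2 => Y j = x), ‖kernel 𝕜 V (2 * q + 1 + 1) Y‖ * wt ((univ.image Y).image πd₁) ≤
        Nt (q + 1) := fun j x => hVN (q + 1) j x
  have hP0 : ∀ (p' : Fin (2 * (q + 1))) (w' : Γ₂ × Fin 2),
      ∑ X'' ∈ univ.filter (fun X'' : Fin (2 * (q + 1)) → Γ₂ × Fin 2 => X'' p' = w'), wt ((univ.image X'').image πd₂) *
        ‖kernel 𝕜 (ExteriorAlgebra.map (Matrix.toLin' Tp) V) (2 * (q + 1)) X''‖ ≤ cr * cc ^ (2 * q + 1) * Nt (q + 1) :=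
    fun p' w' => sum_filter_wt_norm_kernel_map_le hwt πd₁ πd₂ (Matrix.toLin' Tp) hcc0 hrowT hcolT V (2 * q + 1) (hNt0 (q + 1)) hVN' p' w'
  -- (P1) first order: `map T⁺ (e^{Δ} V − V)`
  set Bn : ℝ := ∑ m' ∈ range (Fintype.card (Γ₁ × Fin 2) / 2 + 1),
    if q + 1 < m' then ((2 * m').choose (2 * (q + 1)) : ℝ) * κ ^ (2 * m' - 2 * (q + 1)) * Nt m' else 0 with hBn
  have hBn0 : 0 ≤ Bn := sum_nonneg fun m' _ => by split_ifs <;> first | positivity | exact mul_nonneg (by positivity) (hNt0 _)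
  have hP1 : ∀ (p' : Fin (2 * (q + 1))) (w' : Γ₂ × Fin 2),
      ∑ X'' ∈ univ.filter (fun X'' : Fin (2 * (q + 1)) → Γ₂ × Fin 2 => X'' p' = w'), wt ((univ.image X'').image πd₂) *
        ‖kernel 𝕜 (ExteriorAlgebra.map (Matrix.toLin' Tp) (gaussConv 𝕜 C' V - V)) (2 * (q + 1)) X''‖ ≤ cr * cc ^ (2 * q + 1) * Bn := by
    have hbin : ∀ (i : Fin (2 * (q + 1))) (w : Γ₁ × Fin 2),
        ∑ W ∈ univ.filter (fun W : Fin (2 * (q + 1)) → Γ₁ × Fin 2 => W i = w), ‖kernel 𝕜 (gaussConv 𝕜 C' V - V) (2 * (q + 1)) W‖ *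
          wt ((univ.image W).image πd₁) ≤ Bn := by
      intro i w
      have h := sum_wt_norm_kernel_gaussConv_sub_le_binomial_of_gramBounded_wt C' hwt₁tree hκ.le hGB' V hVe (p := q + 1) Nt hNt0 hVN i w
      refine le_of_eq_of_le (sum_congr rfl fun W _ => mul_comm _ _) h
    intro p' w'
    exact sum_filter_wt_norm_kernel_map_le hwt πd₁ πd₂ (Matrix.toLin' Tp) hcc0 hrowT hcolT _ (2 * q + 1) hBn0 hbin p' w'
  -- (P2) orders ≥ 2: `map T⁺ (effAction C⁺ V − e^{Δ} V)`
  set Gr : ℝ := ∑ n ∈ Ico 2 N₀', (ρ⁻¹ ^ (2 * (q + 1)) * κ⁻¹ ^ (2 * (n - 1)) * (α ^ (n - 1) * Real.exp n)) *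
      ∑ δ ∈ (Fintype.piFinset fun _ : Fin n => range (Fintype.card (Γ₁ × Fin 2) / 2 + 1)) with 2 * (q + 1) + 2 * (n - 1) ≤ ∑ a, 2 * δ a,
        ∏ a, (Real.exp 2 * (κ + ρ)) ^ (2 * δ a) * Nt (δ a) +
    ρ⁻¹ ^ (2 * (q + 1)) * (Real.exp 1 * normV (Γ₁ × Fin 2) κ ρ Nt) * (Real.exp 1 * α * normV (Γ₁ × Fin 2) κ ρ Nt / κ ^ 2) ^ (N₀' - 1) /
      (1 - Real.exp 1 * α * normV (Γ₁ × Fin 2) κ ρ Nt / κ ^ 2) with hGr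
  have hnV0 : 0 ≤ normV (Γ₁ × Fin 2) κ ρ Nt := normV_nonneg hκ.le hρ.le hNt0
  have hθ0 : 0 ≤ Real.exp 1 * α * normV (Γ₁ × Fin 2) κ ρ Nt / κ ^ 2 := by positivity
  have hGr0 : 0 ≤ Gr := by
    refine add_nonneg (sum_nonneg fun n _ => mul_nonneg (by positivity) (sum_nonneg fun δ _ => prod_nonneg fun a _ => ?_))
      (div_nonneg (by positivity) (by linarith))
    exact mul_nonneg (by positivity) (hNt0 _)
  have hP2 : ∀ (p' : Fin (2 * (q + 1))) (w' : Γ₂ × Fin 2),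
      ∑ X'' ∈ univ.filter (fun X'' : Fin (2 * (q + 1)) → Γ₂ × Fin 2 => X'' p' = w'), wt ((univ.image X'').image πd₂) *
        ‖kernel 𝕜 (ExteriorAlgebra.map (Matrix.toLin' Tp) (effAction 𝕜 C' V - gaussConv 𝕜 C' V)) (2 * (q + 1)) X''‖ ≤
        cr * cc ^ (2 * q + 1) * Gr := by
    have hgr : ∀ (i : Fin (2 * (q + 1))) (w : Γ₁ × Fin 2),
        ∑ W ∈ univ.filter (fun W : Fin (2 * (q + 1)) → Γ₁ × Fin 2 => W i = w),
          ‖kernel 𝕜 (effAction 𝕜 C' V - gaussConv 𝕜 C' V) (2 * (q + 1)) W‖ * wt ((univ.image W).image πd₁) ≤ Gr := by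
      intro i w
      have h := sum_wt_norm_kernel_effAction_sub_gaussConv_le_graded_of_gramBounded C' hwt₁tree hκ hGB' V hVe hV0 Nt hNt0 hVN hα
        hrow₁ hcol₁ hρ hθ hN₀' (by positivity : 0 < 2 * (q + 1)) i w
      refine le_of_eq_of_le (sum_congr rfl fun W _ => mul_comm _ _) h
    intro p' w'
    exact sum_filter_wt_norm_kernel_map_le hwt πd₁ πd₂ (Matrix.toLin' Tp) hcc0 hrowT hcolT _ (2 * q + 1) hGr0 hgr p' w'
  -- assembling the three pieces on the full pinned sum of `map T⁺ (effAction C⁺ V)`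
  have hsplit : ExteriorAlgebra.map (Matrix.toLin' Tp) (effAction 𝕜 C' V) =
      ExteriorAlgebra.map (Matrix.toLin' Tp) (effAction 𝕜 C' V - gaussConv 𝕜 C' V) +
        ExteriorAlgebra.map (Matrix.toLin' Tp) (gaussConv 𝕜 C' V - V) + ExteriorAlgebra.map (Matrix.toLin' Tp) V := by
    rw [← map_add, ← map_add]; congr 1; abel
  have hfull : ∑ X'' ∈ univ.filter (fun X'' : Fin (2 * (q + 1)) → Γ₂ × Fin 2 => X'' p = w''), wt ((univ.image X'').image πd₂) *
      ‖kernel 𝕜 (ExteriorAlgebra.map (Matrix.toLin' Tp) (effAction 𝕜 C' V)) (2 * (q + 1)) X''‖ ≤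
      cr * cc ^ (2 * q + 1) * (Nt (q + 1) + Bn + Gr) := by
    calc ∑ X'' ∈ univ.filter (fun X'' : Fin (2 * (q + 1)) → Γ₂ × Fin 2 => X'' p = w''), wt ((univ.image X'').image πd₂) *
          ‖kernel 𝕜 (ExteriorAlgebra.map (Matrix.toLin' Tp) (effAction 𝕜 C' V)) (2 * (q + 1)) X''‖
        ≤ ∑ X'' ∈ univ.filter (fun X'' : Fin (2 * (q + 1)) → Γ₂ × Fin 2 => X'' p = w''),
            (wt ((univ.image X'').image πd₂) *
              ‖kernel 𝕜 (ExteriorAlgebra.map (Matrix.toLin' Tp) (effAction 𝕜 C' V - gaussConv 𝕜 C' V)) (2 * (q + 1)) X''‖ +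
            wt ((univ.image X'').image πd₂) *
              ‖kernel 𝕜 (ExteriorAlgebra.map (Matrix.toLin' Tp) (gaussConv 𝕜 C' V - V)) (2 * (q + 1)) X''‖ +
            wt ((univ.image X'').image πd₂) * ‖kernel 𝕜 (ExteriorAlgebra.map (Matrix.toLin' Tp) V) (2 * (q + 1)) X''‖) := by
          refine sum_le_sum fun X'' _ => ?_
          rw [← mul_add, ← mul_add]
          refine mul_le_mul_of_nonneg_left ?_ (hwt.nonneg _)
          rw [hsplit, kernel_add, kernel_add]
          exact (norm_add_le _ _).trans (add_le_add (norm_add_le _ _) le_rfl)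
      _ ≤ cr * cc ^ (2 * q + 1) * Gr + cr * cc ^ (2 * q + 1) * Bn + cr * cc ^ (2 * q + 1) * Nt (q + 1) := by
          rw [sum_add_distrib, sum_add_distrib]
          exact add_le_add (add_le_add (hP2 p w'') (hP1 p w'')) (hP0 p w'')
      _ = cr * cc ^ (2 * q + 1) * (Nt (q + 1) + Bn + Gr) := by ring
  -- the species read-off
  have hkey := sum_species_norm_kernel_map_effAction_eq C' hCsrc D hD0 (Matrix.toLin' Tp)
    (fun X X'' h => hTsrc X X'' (by rwa [hTm] at h)) ht
    (univ.filter (fun X'' : Fin (2 * (q + 1)) → Γ₂ × Fin 2 => X'' p = w'')) (fun X'' => wt ((univ.image X'').image πd₂)) hs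
  have hsub : ∑ X'' ∈ (univ.filter (fun X'' : Fin (2 * (q + 1)) → Γ₂ × Fin 2 => X'' p = w'')).filter
        (fun X'' => srcCount (fun Y : Γ₂ × Fin 2 => Y.2 = 1) X'' = s),
      ‖kernel 𝕜 (ExteriorAlgebra.map (Matrix.toLin' Tp) (effAction 𝕜 C' V)) (2 * (q + 1)) X''‖ * wt ((univ.image X'').image πd₂) ≤
      cr * cc ^ (2 * q + 1) * (Nt (q + 1) + Bn + Gr) := by
    refine (sum_le_sum_of_subset_of_nonneg (filter_subset _ _) fun X'' _ _ => mul_nonneg (norm_nonneg _) (hwt.nonneg _)).trans ?_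
    exact (le_of_eq (sum_congr rfl fun X'' _ => mul_comm _ _)).trans hfull
  calc ∑ X'' ∈ univ.filter (fun X'' : Fin (2 * (q + 1)) → Γ₂ × Fin 2 => X'' p = w'' ∧ srcCount (fun Y : Γ₂ × Fin 2 => Y.2 = 1) X'' = s),
        wt ((univ.image X'').image fun Y : Γ₂ × Fin 2 => π₂ Y.1) *
          ‖kernel 𝕜 (ExteriorAlgebra.map (Matrix.toLin' Tp) (effAction 𝕜 C' D)) (2 * (q + 1)) X''‖
      = ∑ X'' ∈ (univ.filter (fun X'' : Fin (2 * (q + 1)) → Γ₂ × Fin 2 => X'' p = w'')).filter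
          (fun X'' => srcCount (fun Y : Γ₂ × Fin 2 => Y.2 = 1) X'' = s),
          ‖kernel 𝕜 (ExteriorAlgebra.map (Matrix.toLin' Tp) (effAction 𝕜 C' D)) (2 * (q + 1)) X''‖ * wt ((univ.image X'').image πd₂) := by
        rw [filter_filter]
        exact sum_congr rfl fun X'' _ => mul_comm _ _
    _ = t⁻¹ ^ s * ∑ X'' ∈ (univ.filter (fun X'' : Fin (2 * (q + 1)) → Γ₂ × Fin 2 => X'' p = w'')).filter
          (fun X'' => srcCount (fun Y : Γ₂ × Fin 2 => Y.2 = 1) X'' = s),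
          ‖kernel 𝕜 (ExteriorAlgebra.map (Matrix.toLin' Tp) (effAction 𝕜 C' V)) (2 * (q + 1)) X''‖ * wt ((univ.image X'').image πd₂) := hkey
    _ ≤ t⁻¹ ^ s * (cr * cc ^ (2 * q + 1) * (Nt (q + 1) + Bn + Gr)) :=
        mul_le_mul_of_nonneg_left hsub (pow_nonneg (inv_nonneg.2 ht.le) _)

end Step

end Summit.HubbardSuperconductivity.HubbardSuperconductivity.Theorems.TwoVolumeDefect

end
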